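import Literature.AnabelianGeometry.SemiGraphs.TemperedPiVerticialLevelData
import Literature.AnabelianGeometry.SemiGraphs.TemperedVerticialInjective
import Literature.AnabelianGeometry.SemiGraphs.TemperedPiSystemSurj
import HarnessLib

/-!
# Torsor characters of `π₁^temp(𝒢)` from compatible local characters

Mochizuki, *Semi-graphs of anabelioids*, Publ. RIMS **42** (2006), Def. 3.5 (ii) p. 37 (tempered
coverings), Prop. 3.6 (ii) p. 38 (`B^temp(π₁^temp(𝒢)) ⥲ B^temp(𝒢)`), Thm. 3.7 (i) p. 40
[cite: MochizukiSemiAnbd2006, Prop 3.6(ii) p.38].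

PROOF-ONLY file (abc-iut cell, layer L3, row «RAYLESS-STAR·CIV-NEG» brick S5a, seat abc-iut-L3-t8 gen 6):
the construction of abc-iut-L3-d4's `ThetaRayCharacter.lean` (`thetaRay_exists_torsorCover`,
`thetaRay_exists_character`) for an ARBITRARY semi-graph of anabelioids `𝒢` and an arbitrary COMPATIBLE family of
continuous local characters `χV v : Π_v → A`, `χE e : Π_e → A` (`χV v ∘ b_* = χE e` along every branch `b` of
`e` at `v`) into a finite discrete abelian group `A`:

* `exists_torsorCover_of_characters` — the `A`-torsor covering `C_A ∈ B^temp(𝒢)` (every constituent the set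
  `A` with `Π_c` acting by `χ_c`-translation, identity gluings, tempered because split by itself), its right
  translations, and the criterion "a finite covering whose point stabilisers lie in the kernels of the `χ_c`
  splits every component of `C_A`";
* `exists_character_of_characters` — the character `χ : π₁^temp(𝒢) →* A` with `χ ∘ P.decompHom = χV v` for
  every compatible point sequence `P` over any `v`, vanishing on `ker ρ_j` for EVERY level `j` of the canonical
  tower whose point stabilisers lie in the kernels of the local characters (so the level can be prescribed);
* `exists_levelCharacter_of_characters` — its descent to such levels.

Nothing here bears on [IUTchIII] Cor. 3.12.
-/

namespace Literature.AnabelianGeometry.SemiGraphs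

namespace ProfiniteSemiGraph

open CategoryTheory Topology

section TorsorCharacter

variable {𝒢 : ProfiniteSemiGraph.{0}} {A : Type} [CommGroup A] [TopologicalSpace A] [DiscreteTopology A]
  [Finite A] (χV : ∀ v : 𝒢.graph.Vertex, 𝒢.Gv v →ₜ* A) (χE : ∀ e : 𝒢.graph.Edge, 𝒢.Ge e →ₜ* A)

/-- A finite covering `F` is *adapted* to the local characters: the stabiliser of every point of every
constituent of `F` lies in the kernel of the local character. [cite: MochizukiSemiAnbd2006, Def 3.5(ii) p.37] -/
def CovObj.AdaptedTo (F : CovObj 𝒢) : Prop :=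
  (∀ (v : 𝒢.graph.Vertex) (x : (F.SV v).obj.V) (g : 𝒢.Gv v), (F.SV v).obj.ρ g x = x → χV v g = 1) ∧
    ∀ (e : 𝒢.graph.Edge) (x : (F.SE e).obj.V) (g : 𝒢.Ge e), (F.SE e).obj.ρ g x = x → χE e g = 1

/-- **The `A`-torsor covering `C_A` of `𝒢` with its translations**, for a compatible family of continuous
local characters: a TEMPERED covering `T` all of whose vertex constituents are the `Π_v`-set `A`
(`g · s = χV v g * s`), endomorphisms `τ a : T ⟶ T` acting on every vertex constituent by right translation,
and: every finite covering adapted to the characters splits every component of `T`.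
[cite: MochizukiSemiAnbd2006, Def 3.5(ii) p.37] -/
theorem exists_torsorCover_of_characters
    (hχ : ∀ (b : 𝒢.graph.Branch) (v : 𝒢.graph.Vertex) (h : 𝒢.graph.abuts b = some v)
      (t : 𝒢.Ge (𝒢.graph.edgeOf b)), χV v (𝒢.brHom b v h t) = χE (𝒢.graph.edgeOf b) t) :
    ∃ (T : BTempCat 𝒢) (e : ∀ v : 𝒢.graph.Vertex, (T.obj.SV v).obj.V ≃ A) (τ : A → (T.obj ⟶ T.obj)),
      (∀ (v : 𝒢.graph.Vertex) (g : 𝒢.Gv v) (s : (T.obj.SV v).obj.V),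
        e v ((T.obj.SV v).obj.ρ g s) = χV v g * e v s) ∧
      (∀ (a : A) (v : 𝒢.graph.Vertex) (s : (T.obj.SV v).obj.V),
        e v (((τ a).fV v).hom.hom s) = e v s * a) ∧
      ∀ F : CovObj 𝒢, CovObj.AdaptedTo χV χE F → ∀ q : T.obj.Point, F.Splits (T.obj.component q) := by
  classical
  let actV : ∀ v, MulAction (𝒢.Gv v) A := fun v => MulAction.compHom A (χV v).toMonoidHom
  let actE : ∀ e, MulAction (𝒢.Ge e) A := fun e => MulAction.compHom A (χE e).toMonoidHom
  have hstabV : ∀ v (s : A), {g : 𝒢.Gv v | (@Action.ofMulAction (𝒢.Gv v) A _ (actV v)).ρ g s = s} =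
      χV v ⁻¹' {1} := by
    intro v s
    ext g
    simp only [Set.mem_setOf_eq, Set.mem_preimage, Set.mem_singleton_iff]
    change χV v g * s = s ↔ χV v g = 1
    exact mul_eq_right
  have hstabE : ∀ e (s : A), {t : 𝒢.Ge e | (@Action.ofMulAction (𝒢.Ge e) A _ (actE e)).ρ t s = s} =
      χE e ⁻¹' {1} := by
    intro e s
    ext t
    simp only [Set.mem_setOf_eq, Set.mem_preimage, Set.mem_singleton_iff]
    change χE e t * s = s ↔ χE e t = 1
    exact mul_eq_right
  let XV : ∀ v, BTemp (𝒢.Gv v) := fun v => ⟨@Action.ofMulAction (𝒢.Gv v) A _ (actV v),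
    ⟨inferInstanceAs (Countable A), fun s => by
      rw [hstabV v s]
      exact (isOpen_discrete _).preimage (χV v).continuous⟩⟩
  let XE : ∀ e, BTemp (𝒢.Ge e) := fun e => ⟨@Action.ofMulAction (𝒢.Ge e) A _ (actE e),
    ⟨inferInstanceAs (Countable A), fun s => by
      rw [hstabE e s]
      exact (isOpen_discrete _).preimage (χE e).continuous⟩⟩
  have hglue : ∀ (b : 𝒢.graph.Branch) (v : 𝒢.graph.Vertex) (h : 𝒢.graph.abuts b = some v)
      (t : 𝒢.Ge (𝒢.graph.edgeOf b)) (s : A),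
      (Equiv.refl A) ((XE (𝒢.graph.edgeOf b)).obj.ρ t s) =
        ((BTemp.res (𝒢.brHom b v h)).obj (XV v)).obj.ρ t ((Equiv.refl A) s) := by
    intro b v h t s
    change χE (𝒢.graph.edgeOf b) t * s = χV v (𝒢.brHom b v h t) * s
    rw [hχ]
  let CA : CovObj 𝒢 :=
    { SV := fun v => XV v
      SE := fun e => XE e
      glue := fun b v h => BTemp.isoOfEquiv (Equiv.refl A) (hglue b v h) }
  have hfin : CA.IsFinite := ⟨fun _ => inferInstanceAs (Finite A), fun _ => inferInstanceAs (Finite A)⟩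
  have hne : CA.HasNonemptyFibres := ⟨fun _ => ⟨(1 : A)⟩, fun _ => ⟨(1 : A)⟩⟩
  have hsplitV : ∀ v (x s : A) (g : 𝒢.Gv v), (XV v).obj.ρ g x = x → (XV v).obj.ρ g s = s := by
    intro v x s g hx
    change χV v g * x = x at hx
    change χV v g * s = s
    rw [mul_eq_right.mp hx, one_mul]
  have hsplitE : ∀ e (x s : A) (t : 𝒢.Ge e), (XE e).obj.ρ t x = x → (XE e).obj.ρ t s = s := by
    intro e x s t hx
    change χE e t * x = x at hx
    change χE e t * s = s
    rw [mul_eq_right.mp hx, one_mul]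
  have hsplit : ∀ q : CA.Point, CA.SplitsAt CA q := by
    rintro (⟨v, s⟩ | ⟨e, s⟩)
    · exact fun x g hx => hsplitV v x s g hx
    · exact fun x g hx => hsplitE e x s g hx
  have htemp : CA.IsTempered := fun _ => ⟨CA, hfin, hne, fun q _ => hsplit q⟩
  let τV : A → ∀ v, (XV v ⟶ XV v) := fun a v => ObjectProperty.homMk
    { hom := TypeCat.ofHom fun s : A => s * a
      comm := fun g => by
        apply ConcreteCategory.hom_ext
        intro s
        exact mul_assoc (χV v g) (s : A) a }
  let τE : A → ∀ e, (XE e ⟶ XE e) := fun a e => ObjectProperty.homMk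
    { hom := TypeCat.ofHom fun s : A => s * a
      comm := fun t => by
        apply ConcreteCategory.hom_ext
        intro s
        exact mul_assoc (χE e t) (s : A) a }
  let τ : A → (CA ⟶ CA) := fun a =>
    { fV := fun v => τV a v
      fE := fun e => τE a e
      comm := fun b v h => by
        apply ObjectProperty.hom_ext
        apply Action.Hom.ext
        apply ConcreteCategory.hom_ext
        intro s
        rfl }
  refine ⟨⟨CA, htemp⟩, fun _ => Equiv.refl A, τ, fun _ _ _ => rfl, fun _ _ _ => rfl, fun F hF q => ?_⟩
  -- an adapted finite covering splits every component
  refine CA.splits_component q F fun q' _ => ?_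
  rcases q' with ⟨v, s⟩ | ⟨e, s⟩
  · intro x g hgx
    have key : ∀ s' : A, (XV v).obj.ρ g s' = s' := fun s' => by
      change χV v g * s' = s'
      rw [hF.1 v x g hgx, one_mul]
    exact key s
  · intro x g hgx
    have key : ∀ s' : A, (XE e).obj.ρ g s' = s' := fun s' => by
      change χE e g * s' = s'
      rw [hF.2 e x g hgx, one_mul]
    exact key s

/-- **The torsor character**: for a compatible family of continuous local characters there is a character
`χ` of `π₁^temp(𝒢)` (canonical chart) restricting to `χV v` along the decomposition homomorphism of EVERY
compatible point sequence over `v`, and vanishing on `ker ρ_j` for every level `j` of the canonical tower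
ADAPTED to the characters (and for some level). [cite: MochizukiSemiAnbd2006, Prop 3.6(ii) p.38] -/
theorem exists_character_of_characters (h36 : 𝒢.Prop36Hypotheses)
    (hχ : ∀ (b : 𝒢.graph.Branch) (v : 𝒢.graph.Vertex) (h : 𝒢.graph.abuts b = some v)
      (t : 𝒢.Ge (𝒢.graph.edgeOf b)), χV v (𝒢.brHom b v h t) = χE (𝒢.graph.edgeOf b) t) :
    ∃ χ : 𝒢.temperedPi h36 →* A,
      (∀ (v : 𝒢.graph.Vertex) (P : (𝒢.galoisLevelData h36).PointSeq h36.isCountable v) (h : 𝒢.Gv v),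
        χ (P.decompHom h) = χV v h) ∧
      (∀ j : ℕ, CovObj.AdaptedTo χV χE ((𝒢.galoisLevelData h36).S j) →
        ∀ g : 𝒢.temperedPi h36, (𝒢.galoisLevelData h36).proj h36.isCountable j g = 1 → χ g = 1) ∧
      ∃ j₁ : ℕ, ∀ g : 𝒢.temperedPi h36,
        (𝒢.galoisLevelData h36).proj h36.isCountable j₁ g = 1 → χ g = 1 := by
  classical
  obtain ⟨T, e, τ, hρ, hτ, hadapt⟩ := exists_torsorCover_of_characters χV χE hχ
  let D : GaloisLevelData 𝒢 := 𝒢.galoisLevelData h36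
  let v₀ : 𝒢.graph.Vertex := 𝒢.baseVertex h36
  let act : 𝒢.temperedPi h36 → (T.obj.SV v₀).obj.V → (T.obj.SV v₀).obj.V :=
    D.piAct h36.isCountable T.obj (𝒢.levelOf h36 T) (𝒢.levelOf_spec h36 T)
  let s₀ : (T.obj.SV v₀).obj.V := (e v₀).symm 1
  have hs₀ : e v₀ s₀ = 1 := (e v₀).apply_symm_apply 1
  have hcomm : ∀ (a : A) (γ : 𝒢.temperedPi h36) (s : (T.obj.SV v₀).obj.V),
      ((τ a).fV v₀).hom.hom (act γ s) = act γ (((τ a).fV v₀).hom.hom s) := fun a γ s =>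
    D.piAct_map h36.isCountable (τ a) (𝒢.levelOf h36 T) (𝒢.levelOf_spec h36 T) (𝒢.levelOf h36 T)
      (𝒢.levelOf_spec h36 T) γ s
  have htrans : ∀ s : (T.obj.SV v₀).obj.V, ((τ (e v₀ s)).fV v₀).hom.hom s₀ = s := by
    intro s
    apply (e v₀).injective
    rw [hτ, hs₀, one_mul]
  have hact : ∀ (γ : 𝒢.temperedPi h36) (s : (T.obj.SV v₀).obj.V),
      e v₀ (act γ s) = e v₀ (act γ s₀) * e v₀ s := by
    intro γ s
    conv_lhs => rw [← htrans s, ← hcomm]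
    rw [hτ]
  let χ : 𝒢.temperedPi h36 →* A :=
    { toFun := fun γ => e v₀ (act γ s₀)
      map_one' := by
        have h1 : act 1 s₀ = s₀ :=
          D.piAct_one h36.isCountable T.obj (𝒢.levelOf h36 T) (𝒢.levelOf_spec h36 T) s₀
        change e v₀ (act 1 s₀) = 1
        rw [h1]; exact hs₀
      map_mul' := fun γ δ => by
        have hm : act (γ * δ) s₀ = act γ (act δ s₀) :=
          D.piAct_mul h36.isCountable T.obj (𝒢.levelOf h36 T) (𝒢.levelOf_spec h36 T) γ δ s₀
        change e v₀ (act (γ * δ) s₀) = e v₀ (act γ s₀) * e v₀ (act δ s₀)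
        rw [hm, hact γ (act δ s₀)] }
  refine ⟨χ, fun v P h => ?_, fun j hj g hg => ?_, ⟨𝒢.levelOf h36 T s₀, fun g hg => ?_⟩⟩
  · let i := P.restrictVIso
    let φ : (T.obj.SV v₀).obj.V → (T.obj.SV v).obj.V := fun s => (i.inv.app T).hom.hom s
    have hφτ : ∀ (a : A) (s : (T.obj.SV v₀).obj.V),
        φ (((τ a).fV _).hom.hom s) = ((τ a).fV v).hom.hom (φ s) := fun a s =>
      natIso_inv_app_fV i (T := T) (T' := T) (τ a) s
    have hφact : φ (act (P.decompHom h) s₀) = (T.obj.SV v).obj.ρ h (φ s₀) :=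
      natIso_inv_app_piAct i T h s₀
    have h1 : e v (φ (act (P.decompHom h) s₀)) = e v (φ s₀) * χ (P.decompHom h) := by
      have : act (P.decompHom h) s₀ = ((τ (e v₀ (act (P.decompHom h) s₀))).fV v₀).hom.hom s₀ :=
        (htrans _).symm
      rw [this, hφτ, hτ]
      rfl
    have h2 : e v (φ (act (P.decompHom h) s₀)) = χV v h * e v (φ s₀) := by rw [hφact, hρ]
    rw [h1, mul_comm] at h2
    exact mul_right_cancel h2
  · -- vanishing on `ker ρ_j` for an ADAPTED level `j`: compare the actions at the common level `N`
    have hsplit : ∀ (t : (T.obj.SV v₀).obj.V) (n : ℕ), j ≤ n →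
        (D.S n).Splits (T.obj.component (Sum.inl ⟨v₀, t⟩)) := by
      intro t n hn
      induction n, hn using Nat.le_induction with
      | base => exact hadapt _ hj _
      | succ k _ ih => exact D.splits_succ T.obj t k ih
    set N := max (𝒢.levelOf h36 T s₀) j with hN
    have h0 : act g s₀ = s₀ := by
      change D.actAt h36.isCountable T.obj s₀ (𝒢.levelOf h36 T s₀) (𝒢.levelOf_spec h36 T s₀ _ le_rfl)
        (D.proj h36.isCountable (𝒢.levelOf h36 T s₀) g) = s₀
      rw [← D.actAt_proj_eq h36.isCountable T.obj (𝒢.levelOf h36 T) (𝒢.levelOf_spec h36 T) s₀ g N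
        (le_max_left _ _)]
      have h2 := D.actAt_proj_eq h36.isCountable T.obj (fun _ => j) (fun t n hn => hsplit t n hn) s₀ g N
        (le_max_right _ _)
      rw [h2]
      change D.actAt h36.isCountable T.obj s₀ j (hsplit s₀ j le_rfl) (D.proj h36.isCountable j g) = s₀
      rw [hg]
      exact D.actAt_one h36.isCountable T.obj s₀ _ _
    change e v₀ (act g s₀) = 1
    rw [h0]; exact hs₀
  · have h0 : act g s₀ = s₀ :=
      D.piAct_eq_self_of_proj_eq_one h36.isCountable T.obj (𝒢.levelOf h36 T) (𝒢.levelOf_spec h36 T) g s₀ hg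
    change e v₀ (act g s₀) = 1
    rw [h0]; exact hs₀

/-- **Level characters**: the torsor character descends to every level `j` of the canonical tower adapted
to the local characters: `χ_j : Gal(𝒢_{∞,j}/𝒢) →* A` with `χ_j ∘ ρ_j = χ` and `χ_j (P.gal j h) = χV v h`.
[cite: MochizukiSemiAnbd2006, Prop 3.6(ii) p.38] -/
theorem exists_levelCharacter_of_characters (h36 : 𝒢.Prop36Hypotheses)
    (hχ : ∀ (b : 𝒢.graph.Branch) (v : 𝒢.graph.Vertex) (h : 𝒢.graph.abuts b = some v)
      (t : 𝒢.Ge (𝒢.graph.edgeOf b)), χV v (𝒢.brHom b v h t) = χE (𝒢.graph.edgeOf b) t) :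
    ∃ χ : 𝒢.temperedPi h36 →* A,
      (∀ (v : 𝒢.graph.Vertex) (P : (𝒢.galoisLevelData h36).PointSeq h36.isCountable v) (h : 𝒢.Gv v),
        χ (P.decompHom h) = χV v h) ∧
      ∀ j : ℕ, CovObj.AdaptedTo χV χE ((𝒢.galoisLevelData h36).S j) →
        ∃ χj : (𝒢.galoisLevelData h36).Gal h36.isCountable j →* A,
          (∀ g, χj ((𝒢.galoisLevelData h36).proj h36.isCountable j g) = χ g) ∧
          ∀ (v : 𝒢.graph.Vertex) (P : (𝒢.galoisLevelData h36).PointSeq h36.isCountable v) (h : 𝒢.Gv v),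
            χj (P.gal j h) = χV v h := by
  obtain ⟨χ, hχP, hadapt, -⟩ := exists_character_of_characters χV χE h36 hχ
  refine ⟨χ, hχP, fun j hj => ?_⟩
  have hker : ((𝒢.galoisLevelData h36).proj h36.isCountable j).ker ≤ χ.ker := fun g hg =>
    (MonoidHom.mem_ker).mpr (hadapt j hj g ((MonoidHom.mem_ker).mp hg))
  refine ⟨((𝒢.galoisLevelData h36).proj h36.isCountable j).liftOfSurjective
      ((𝒢.galoisLevelData h36).proj_surjective h36.isCountable j) ⟨χ, hker⟩, fun g => ?_, fun v P h => ?_⟩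
  · exact ((𝒢.galoisLevelData h36).proj h36.isCountable j).liftOfRightInverse_comp_apply _ _ ⟨χ, hker⟩ g
  · rw [← P.proj_decompHom j h,
      ((𝒢.galoisLevelData h36).proj h36.isCountable j).liftOfRightInverse_comp_apply _ _ ⟨χ, hker⟩]
    exact hχP v P h

end TorsorCharacter

end ProfiniteSemiGraph

end Literature.AnabelianGeometry.SemiGraphs
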